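import Summits.QuantumFields.YangMills.Theorems.FluctuationComparisonRegPrIntLS2BetaHaarCapComplement
import Summits.QuantumFields.YangMills.Theorems.FluctuationComparisonRegPrIntLS2BetaLiftLadderCombRow
import HarnessLib

/-!
# S2β · D-GUARD ∕ (BG∞) — THE ANTIPODAL CONE CENTRE: a point `r`-far from a finite family is, after passing to its ANTIPODE `p·expPoint(π e₀)`, a cone centre in whose
# chart the whole family lies `(π − r)`-inside — the one sentence between (G4) ✓`…HaarCapComplement.exists_forall_le_arc_of_patched` and (G5) ✓`…ExpChartLipschitzOffCap.dist1_cone_mul_inv_cone_le`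

Cell `ym3-torus` (YM ladder rung R3 = continuum `SU(2)` Yang–Mills on the three-torus at fixed lattice data — a RUNG: NOT d = 4, NOT infinite volume,
NOT a mass gap, NOT Clay).  Width seat «width 19» `ym3-torus-px19` (gen 25, ★p1 lineage), FREE px helper on crux `stmt-QuantumFields-20520`
(`FluctuationComparisonRegPrIntL`; registry `Lines/semiclassical_s2beta.lean` UNTOUCHED, 0∕5); `--kind proof --supports stmt-QuantumFields-20520 --as helper`,
count-neutral, DEFINITION-FREE (0 `def`, 0 `instance`, 0 `notation`, 0 `sorry`, default heartbeats).  Own-risk pen announced STATUS 2026-09-01T00:42:49Z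
(after the architect ruling «(BG∞) PLAN OF RECORD = UV3-NODE §116», px17 g23 00:13:02Z).

WHY.  Fillings T (tube) and S (sphere) of the (BG∞) gluing (UV3-NODE §116.3) cone a discrete loop ∕ sphere `φ : κ → SU(2)` toward a centre `c` whose ANTIPODAL cap
the family avoids.  (G4) — px5 g24 ✓`exists_forall_le_arc_of_patched` (Haar union bound) or LEAD w3 g29 ✓`…FarPointPigeonhole` — delivers a point `p` with
`r ≤ arc((φ k)⁻¹ p)` for all `k`; (G5) — ✓`dist1_cone_mul_inv_cone_le (c q q′) (hx : arc(c⁻¹ q) ≤ π − r) …` — wants the family `(π − r)`-INSIDE the chart at the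
centre.  The centre is the antipode `c := p·expPoint(π e₀)` (`su2Quat c = −su2Quat p`), and `arc(c⁻¹ q) = π − arc(p⁻¹ q)` because `‖logVec(−X)‖ = π − ‖logVec X‖`
(`arccos(−t) = π − arccos t`).  THIS FILE is that bookkeeping plus the composed engine «patched family ⟹ cone centre».

WHAT IS PROVED (sorry-free; `e₀ := EuclideanSpace.single 0 1`).
* §1 `norm_pi_smul_single` (`‖π • e₀‖ = π`), ★ `su2Quat_expPoint_pi_smul_single` (`su2Quat (expPoint (π • e₀)) = −1`), `norm_logVec_neg` (`‖logVec (−q)‖ = π − ‖logVec q‖`, any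
  quaternion), ★ `su2Quat_mul_expPoint_pi` (`su2Quat (p * expPoint (π • e₀)) = −su2Quat p`).
* §2 ★★ `norm_logVec_antipode_inv_mul` — `‖logVec (su2Quat ((p * expPoint (π • e₀))⁻¹ * q))‖ = π − ‖logVec (su2Quat (p⁻¹ * q))‖`;
  ★★ `norm_logVec_antipode_inv_mul_le` — `r ≤ ‖logVec (su2Quat (q⁻¹ * p))‖ ⟹ ‖logVec (su2Quat ((p * expPoint (π • e₀))⁻¹ * q))‖ ≤ π − r` ((G4)'s output shape in,
  (G5)'s input shape out; ✓`norm_logVec_su2Quat_inv`).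
* §3 ★★★ `exists_coneCentre_of_patched` — (G4) ∘ antipode: for a finite set of patch centres `c : ι → SU2` covering the family `φ : κ → SU2` at radius `r∕2` with
  `card ι · (2∕(3π))·(3r∕2)³ < 1`: `∃ a : SU2, ∀ k, ‖logVec (su2Quat (a⁻¹ * φ k))‖ ≤ π − r` — feed `a` to ✓`dist1_cone_mul_inv_cone_le` and every cone at parameter `s`
  is `s·((π − r)∕sin r)`-Lipschitz on the family.

HONEST SCOPE.  Quaternion ∕ arccos bookkeeping over landed theorems; nothing of Bałaban's renormalisation-group analysis is asserted or proved ([Balaban1985RegularSpaces]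
(1.29) p.81, Thm 2 p.83 — the local small-bond gauges the (BG∞) road globalises).  (BG∞) ∕ `hsupp⁺` is a CONJECTURE (LEAD §114.3, plan §116, FL-39 alive) and is
NOT proved; (G6)–(G8) and Case S are OPEN; GAP♯∘ (`stub_uniformFibreGapOrbit`, registry UNTOUCHED), the five registered stubs (0∕5), S2β, 20520, 19936, 19200,
`YM3TorusSU2` are NOT proved; no registered stub is closed; rung R3 — NOT d = 4, NOT infinite volume, NOT a mass gap, NOT Clay; the Yang–Mills mass gap is NOT
proved.  Axioms standard.

References: T. Bałaban, CMP **99** (1985) 75–102 [Balaban1985RegularSpaces] ((1.29) p.81, Thm 2 p.83); I. Chevyrev, CMP **372** (2019), Lemma 4.14 (the quantitative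
null-homotopy our cones replace).
-/

set_option autoImplicit false

noncomputable section

namespace Summit.QuantumFields.YangMills.Theorems.FluctuationComparisonRegPrIntLS2BetaAntipodalConeCentre

open NormedSpace
open scoped Real Quaternion
open Literature.MathematicalPhysics.QuantumLattice (su2Quat norm_su2Quat)
open Literature.MathematicalPhysics.QuantumFieldTheory.Balaban1983to89
open T4CubeChartGnomonic (SU2)
open T4HaarSU2ExpChart (imQuat imQuat_re exp_imQuat expPoint su2Quat_expPoint)
open T4HaarSU2Translate (su2Quat_mul)
open T4WilsonLinkAffine (su2Quat_inv)
open T4ExpWindowSmallField (logVec norm_logVec norm_logVec_le_pi)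
open Summit.QuantumFields.YangMills.Theorems.FluctuationComparisonRegPrIntLS2BetaLiftLadderCombRow (norm_logVec_su2Quat_inv)
open Summit.QuantumFields.YangMills.Theorems.FluctuationComparisonRegPrIntLS2BetaHaarCapComplement (exists_forall_le_arc_of_patched)

/-! ## §1 The antipode through the chart -/

/-- `‖π • e₀‖ = π`. [folklore] -/
theorem norm_pi_smul_single : ‖(π : ℝ) • (EuclideanSpace.single 0 1 : EuclideanSpace ℝ (Fin 3))‖ = π := by
  have h1 : ‖(EuclideanSpace.single 0 1 : EuclideanSpace ℝ (Fin 3))‖ = 1 := by simp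
  rw [norm_smul, h1, mul_one, Real.norm_eq_abs, abs_of_pos Real.pi_pos]

/-- ★ The chart reaches the antipode at radius `π`: `su2Quat (expPoint (π • e₀)) = −1`. [folklore] -/
theorem su2Quat_expPoint_pi_smul_single :
    su2Quat (expPoint ((π : ℝ) • (EuclideanSpace.single 0 1 : EuclideanSpace ℝ (Fin 3)))) = -1 := by
  letI : NormedAlgebra ℚ ℍ := NormedAlgebra.restrictScalars ℚ ℝ ℍ
  rw [su2Quat_expPoint, exp_imQuat, norm_pi_smul_single, Real.cos_pi, Real.sinc_of_ne_zero Real.pi_ne_zero, Real.sin_pi, zero_div,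
    zero_smul, add_zero]
  norm_num

/-- ★ The antipode of `p`: `su2Quat (p * expPoint (π • e₀)) = −su2Quat p`. [folklore] -/
theorem su2Quat_mul_expPoint_pi (p : SU2) :
    su2Quat (p * expPoint ((π : ℝ) • (EuclideanSpace.single 0 1 : EuclideanSpace ℝ (Fin 3)))) = -su2Quat p := by
  rw [su2Quat_mul, su2Quat_expPoint_pi_smul_single, mul_neg_one]

/-- `‖logVec (−q)‖ = π − ‖logVec q‖` (`arccos(−t) = π − arccos t`). [folklore] -/
theorem norm_logVec_neg (q : ℍ) : ‖logVec (-q)‖ = π - ‖logVec q‖ := by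
  rw [norm_logVec, norm_logVec, Quaternion.re_neg, Real.arccos_neg]

/-! ## §2 The chart at the antipodal centre -/

/-- ★★ **THE ANTIPODAL CENTRE FLIPS THE ARC**: `‖logVec (su2Quat ((p·expPoint(π e₀))⁻¹ · q))‖ = π − ‖logVec (su2Quat (p⁻¹ · q))‖`. [folklore] -/
theorem norm_logVec_antipode_inv_mul (p q : SU2) :
    ‖logVec (su2Quat ((p * expPoint ((π : ℝ) • (EuclideanSpace.single 0 1 : EuclideanSpace ℝ (Fin 3))))⁻¹ * q))‖ =
      π - ‖logVec (su2Quat (p⁻¹ * q))‖ := by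
  have h : su2Quat ((p * expPoint ((π : ℝ) • (EuclideanSpace.single 0 1 : EuclideanSpace ℝ (Fin 3))))⁻¹ * q) = -su2Quat (p⁻¹ * q) := by
    rw [su2Quat_mul, su2Quat_inv, su2Quat_mul_expPoint_pi, star_neg, su2Quat_mul, su2Quat_inv, neg_mul]
  rw [h, norm_logVec_neg]

/-- ★★ **(G4)'s OUTPUT IN, (G5)'s INPUT OUT**: if `q` is `r`-far from `p` (`r ≤ arc(q⁻¹ p)`, the shape of ✓`exists_forall_le_arc_of_patched`), then in the chart at the
antipode `a := p·expPoint(π e₀)` it lies `(π − r)`-inside: `arc(a⁻¹ q) ≤ π − r` (the shape of ✓`dist1_cone_mul_inv_cone_le`'s hypotheses). [folklore] -/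
theorem norm_logVec_antipode_inv_mul_le (p q : SU2) {r : ℝ} (hr : r ≤ ‖logVec (su2Quat (q⁻¹ * p))‖) :
    ‖logVec (su2Quat ((p * expPoint ((π : ℝ) • (EuclideanSpace.single 0 1 : EuclideanSpace ℝ (Fin 3))))⁻¹ * q))‖ ≤ π - r := by
  rw [norm_logVec_antipode_inv_mul]
  have h : ‖logVec (su2Quat (p⁻¹ * q))‖ = ‖logVec (su2Quat (q⁻¹ * p))‖ := by
    rw [← norm_logVec_su2Quat_inv, mul_inv_rev, inv_inv]
  linarith

/-! ## §3 The composed engine: a patched family has a cone centre -/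

/-- ★★★ **A PATCHED FINITE FAMILY HAS A CONE CENTRE** ((G4) ✓`exists_forall_le_arc_of_patched` ∘ antipode): if the family `φ : κ → SU(2)` is covered at arc-radius
`r∕2` by the patch centres `c : ι → SU(2)` and `card ι · (2∕(3π))·(3r∕2)³ < 1`, then some `a : SU(2)` has the WHOLE family `(π − r)`-inside its chart —
so by ✓`dist1_cone_mul_inv_cone_le` the cone toward `a` at parameter `s` is `s·((π − r)∕sin r)`-Lipschitz on the family (fillings T∕S of UV3-NODE §116.3).
[cite: Balaban1985RegularSpaces, Thm 2 p.83] -/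
theorem exists_coneCentre_of_patched {ι κ : Type*} [Fintype ι] (c : ι → SU2) (φ : κ → SU2) {r : ℝ} (hr0 : 0 ≤ r) (hrπ : 3 * r / 2 ≤ π)
    (hpatch : ∀ k, ∃ i, ‖logVec (su2Quat ((c i)⁻¹ * φ k))‖ ≤ r / 2)
    (hcard : (Fintype.card ι : ℝ) * (2 / (3 * π) * (3 * r / 2) ^ 3) < 1) :
    ∃ a : SU2, ∀ k, ‖logVec (su2Quat (a⁻¹ * φ k))‖ ≤ π - r := by
  obtain ⟨p, hp⟩ := exists_forall_le_arc_of_patched c φ hr0 hrπ hpatch hcard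
  exact ⟨p * expPoint ((π : ℝ) • (EuclideanSpace.single 0 1 : EuclideanSpace ℝ (Fin 3))), fun k => norm_logVec_antipode_inv_mul_le p (φ k) (hp k)⟩

end Summit.QuantumFields.YangMills.Theorems.FluctuationComparisonRegPrIntLS2BetaAntipodalConeCentre

end
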